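import Mathlib
import Summits.Ventures.PercRepro2.Defs
import Summits.Ventures.PercRepro2.Independence
import Summits.Ventures.PercRepro2.Harris
import Summits.Ventures.PercRepro2.Graph
import Summits.Ventures.PercRepro2.Exploration
import Summits.Ventures.PercRepro2.Events
import Summits.Ventures.PercRepro2.FourFunctions
import Summits.Ventures.PercRepro2.Induced
import Summits.Ventures.PercRepro2.Frontier
import Summits.Ventures.PercRepro2.ObsIndependence
import Summits.Ventures.PercRepro2.BHK
import Summits.Ventures.PercRepro2.BHKEvents
import Summits.Ventures.PercRepro2.MultiSource
import Summits.Ventures.PercRepro2.OrderPreservation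
import Summits.Ventures.PercRepro2.SeedSet
import Summits.Ventures.PercRepro2.MultiSourceFun
import Summits.Ventures.PercRepro2.CrossRootT
import Summits.Ventures.PercRepro2.VdBKahn
import Summits.Ventures.PercRepro2.HullDefs
import Summits.Ventures.PercRepro2.CCTRootEdge
import Summits.Ventures.PercRepro2.CCTAvoidedEdge
import Summits.Ventures.PercRepro2.R1Rung
import Summits.Ventures.PercRepro2.CC2Rung
import Summits.Ventures.PercRepro2.PASubDefs
import Summits.Ventures.PercRepro2.HalfN
import Summits.Ventures.PercRepro2.CCTLin
import Summits.Ventures.PercRepro2.L1SDefs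

/-!
# The S-frame, part 2: events of `G − W` and BHK on `G − W` (blind cell PercRepro2, typer-1;
mine-c g3 MINE-C.md §10.3 "BHK 1.3 in `G − S` (root `w`, avoided `T`)")

For a vertex set `W` (the `e`-closed cluster `S` of the root in the S-frame) and the merge vertex
`w ∉ W`, the events of `G − W` (edges at `W` deleted, `delConfig`): `{C_{G−W}(w) ∈ 𝓤}`
(`delClusterIn`) and `{C_{G−W}(w) ∩ T = ∅}` (`delAvoid`), which depend only on the edges not
touching `W`. `G − W` is percolation on the induced subgraph `G[Wᶜ]` (`delConfig_eq_induced`), so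
van den Berg–Häggström–Kahn on induced subgraphs (`bhk_induced`) gives

**`bhk_del`**: for up-sets `𝓤, 𝓥` and `T ⊆ Wᶜ`,
`P(C ∈ 𝓤, C ∩ T = ∅) · P(C ∈ 𝓥, C ∩ T = ∅) ≤ P(C ∈ 𝓤 ∩ 𝓥, C ∩ T = ∅) · P(C ∩ T = ∅)`, `C = C_{G−W}(w)`.

Used by `L1S.lean` for the merge class of the reduction (L1-S) ⟹ (CC-T).
-/

namespace Summit.Ventures.PercRepro2

namespace SFrame

open PASub CCTLin TwoSetRung

open scoped Classical

variable {V : Type*} {E : Type*} [Fintype E] [DecidableEq E] [Fintype V] [DecidableEq V]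
  {R : Type*} [Field R] [LinearOrder R] [IsStrictOrderedRing R]

/-! ## Events of `G − W` -/

section DelEvents

variable (ends : E → Sym2 V) (W : Set V) (w : V) (T : Finset V)

/-- `{C_{G−W}(w) ∈ 𝓤}`: a cluster event of `w` in `G − W`. -/
def delClusterIn (𝓤 : Set (Set V)) : Set (Config E) :=
  {ω | cluster ends (delConfig ends W ω) w ∈ 𝓤}

/-- `{C_{G−W}(w) ∩ T = ∅}`: `w` avoids `T` in `G − W`. -/
def delAvoid : Set (Config E) := {ω | ∀ t ∈ T, t ∉ cluster ends (delConfig ends W ω) w}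

omit [Fintype E] [DecidableEq E] [Fintype V] [DecidableEq V] in
/-- Cluster events of `G − W` depend only on the edges not touching `W`. -/
lemma dependsOn_delClusterIn (𝓤 : Set (Set V)) :
    DependsOn (· ∈ delClusterIn ends W w 𝓤) (touches ends W)ᶜ := by
  intro ω ω' h
  show (cluster ends (delConfig ends W ω) w ∈ 𝓤) = (cluster ends (delConfig ends W ω') w ∈ 𝓤)
  rw [delConfig_congr h]

omit [Fintype E] [DecidableEq E] [Fintype V] [DecidableEq V] in
/-- The avoidance event of `G − W` depends only on the edges not touching `W`. -/
lemma dependsOn_delAvoid : DependsOn (· ∈ delAvoid ends W w T) (touches ends W)ᶜ := by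
  intro ω ω' h
  show (∀ t ∈ T, t ∉ cluster ends (delConfig ends W ω) w) =
    (∀ t ∈ T, t ∉ cluster ends (delConfig ends W ω') w)
  rw [delConfig_congr h]

omit [Fintype E] [DecidableEq E] [Fintype V] [DecidableEq V] in
/-- Every edge has two ends. -/
lemma exists_ends_eq (e : E) : ∃ x y, ends e = s(x, y) := by
  rcases Sym2.mk_surjective (ends e) with ⟨⟨x, y⟩, hxy⟩
  exact ⟨x, y, hxy.symm⟩

omit [Fintype E] [DecidableEq E] [Fintype V] [DecidableEq V] in
/-- `G − W` is percolation on the induced subgraph `G[Wᶜ]`. -/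
lemma delConfig_eq_induced (ω : Config E) : delConfig ends W ω = induced ends Wᶜ ω := by
  funext e'
  by_cases h : e' ∈ touches ends W
  · rw [delConfig_apply_of_mem h]
    cases hI : induced ends Wᶜ ω e'
    · rfl
    · exfalso
      obtain ⟨_, x, hx, y, hy, hxy⟩ := induced_eq_true_iff.1 hI
      obtain ⟨z, hz, z', hzz'⟩ := h
      rw [hxy, Sym2.eq_iff] at hzz'
      rcases hzz' with ⟨rfl, rfl⟩ | ⟨rfl, rfl⟩
      · exact hx hz
      · exact hy hz
  · rw [delConfig_apply_of_notMem h]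
    cases hI : induced ends Wᶜ ω e'
    · cases hω : ω e'
      · rfl
      · exfalso
        obtain ⟨x, y, hxy⟩ := exists_ends_eq ends e'
        have hin : e' ∈ within ends Wᶜ := by
          refine ⟨x, ?_, y, ?_, hxy⟩
          · intro hxW; exact h ⟨x, hxW, y, hxy⟩
          · intro hyW; exact h ⟨y, hyW, x, by rw [hxy, Sym2.eq_swap]⟩
        have : induced ends Wᶜ ω e' = true := induced_eq_true_iff.2 ⟨hω, hin⟩
        rw [hI] at this
        exact Bool.false_ne_true this
    · exact (induced_eq_true_iff.1 hI).1

/-- The vertex set `Wᶜ` as a finset. -/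
noncomputable def complFinset : Finset V := Finset.univ.filter (fun x => x ∉ W)

omit [Fintype E] [DecidableEq E] [DecidableEq V] in
/-- `↑(complFinset W) = Wᶜ`. -/
lemma coe_complFinset : (↑(complFinset (V := V) W) : Set V) = Wᶜ := by
  ext x; simp [complFinset]

omit [Fintype E] [DecidableEq E] [DecidableEq V] in
/-- The cluster of `w` in `G[Wᶜ]` is its cluster in `G − W`. -/
lemma clusterIn_compl_eq (ω : Config E) :
    clusterIn ends (complFinset W) w ω = cluster ends (delConfig ends W ω) w := by
  unfold clusterIn
  rw [coe_complFinset, delConfig_eq_induced]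

omit [Fintype E] [DecidableEq E] [DecidableEq V] in
/-- The avoidance event of `G[Wᶜ]` is the avoidance event of `G − W`. -/
lemma REvent_compl_eq : REvent ends (complFinset W) w T = delAvoid ends W w T := by
  ext ω
  simp only [REvent, delAvoid, Set.mem_setOf_eq, coe_complFinset, ← delConfig_eq_induced,
    mem_cluster]

end DelEvents

/-! ## BHK on `G − W` -/

section DelBHK

variable (p : E → R) (ends : E → Sym2 V) (W : Set V) (w : V) (T : Finset V)

omit [DecidableEq V] [LinearOrder R] [IsStrictOrderedRing R] in
/-- Cluster observables of `G[Wᶜ]` as functions of the `G − W` cluster. -/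
lemma expect_clusterObs_mul (F : Set V → R) (A : Set (Config E)) :
    expect p (clusterObs ends (complFinset W) w F * A.indicator 1) =
      expect p (fun ω => F (cluster ends (delConfig ends W ω) w) * A.indicator 1 ω) := by
  congr 1
  funext ω
  rw [Pi.mul_apply, clusterObs_apply, clusterIn_compl_eq]

omit [Fintype V] [DecidableEq V] [LinearOrder R] [IsStrictOrderedRing R] in
/-- `E[1_𝓤(C_{G−W}(w)) · 1_A] = P({C_{G−W}(w) ∈ 𝓤} ∩ A)`. -/
lemma expect_indicator_mul_eq_prob (𝓤 : Set (Set V)) (A : Set (Config E)) :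
    expect p (fun ω => 𝓤.indicator (1 : Set V → R) (cluster ends (delConfig ends W ω) w) *
        A.indicator 1 ω) =
      prob p (delClusterIn ends W w 𝓤 ∩ A) := by
  rw [prob_eq_expect_indicator]
  congr 1
  funext ω
  rw [indicator_inter_one]
  congr 1

omit [Fintype V] [DecidableEq V] [LinearOrder R] [IsStrictOrderedRing R] in
/-- `E[1_𝓤(C) · 1_𝓥(C) · 1_A] = P({C ∈ 𝓤} ∩ {C ∈ 𝓥} ∩ A)` for `C = C_{G−W}(w)`. -/
lemma expect_indicator_mul_indicator_mul_eq_prob (𝓤 𝓥 : Set (Set V)) (A : Set (Config E)) :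
    expect p (fun ω => 𝓤.indicator (1 : Set V → R) (cluster ends (delConfig ends W ω) w) *
        𝓥.indicator (1 : Set V → R) (cluster ends (delConfig ends W ω) w) * A.indicator 1 ω) =
      prob p (delClusterIn ends W w 𝓤 ∩ delClusterIn ends W w 𝓥 ∩ A) := by
  rw [prob_eq_expect_indicator]
  congr 1
  funext ω
  rw [indicator_inter_one, indicator_inter_one]
  congr 1

/-- **BHK on `G − W`** (BHK06 Thm 1.3 on the induced subgraph `G[Wᶜ]`): for up-sets `𝓤, 𝓥` and an
avoided set `T ⊆ Wᶜ`, `P(C ∈ 𝓤, C ∩ T = ∅) · P(C ∈ 𝓥, C ∩ T = ∅) ≤ P(C ∈ 𝓤 ∩ 𝓥, C ∩ T = ∅) · P(C ∩ T = ∅)`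
for the cluster `C = C_{G−W}(w)`. -/
theorem bhk_del (hp : IsProbVec p) {𝓤 𝓥 : Set (Set V)} (h𝓤 : IsUpperSet 𝓤) (h𝓥 : IsUpperSet 𝓥)
    (hT : ∀ t ∈ T, t ∉ W) :
    prob p (delClusterIn ends W w 𝓤 ∩ delAvoid ends W w T) *
        prob p (delClusterIn ends W w 𝓥 ∩ delAvoid ends W w T) ≤
      prob p (delClusterIn ends W w 𝓤 ∩ delClusterIn ends W w 𝓥 ∩ delAvoid ends W w T) *
        prob p (delAvoid ends W w T) := by
  have hTU : T ⊆ complFinset W := fun t ht => by simp [complFinset, hT t ht]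
  have key := bhk_induced p hp ends w (monotone_indicator_one_of_isUpperSet (R := R) h𝓤)
    (monotone_indicator_one_of_isUpperSet (R := R) h𝓥)
    (fun _ => Set.indicator_apply_nonneg fun _ => zero_le_one)
    (fun _ => Set.indicator_apply_nonneg fun _ => zero_le_one) (complFinset W) T T hTU hTU
  rw [Finset.inter_self, Finset.union_self, REvent_compl_eq, expect_clusterObs_mul,
    expect_clusterObs_mul, expect_clusterObs_mul, expect_indicator_mul_eq_prob,
    expect_indicator_mul_eq_prob] at key
  simp only [Pi.mul_apply] at key
  rw [expect_indicator_mul_indicator_mul_eq_prob] at key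
  exact key

end DelBHK

end SFrame

end Summit.Ventures.PercRepro2
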